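import Summits.ABC.IUTFork.ForkHexagon
import Summits.ABC.IUTFork.ForkPilots
import HarnessLib

/-!
# The fork at [IUTchIII] Corollary 3.12, XXI: LANA's pilots (XIV) are Dupuy–Hilado's pilot degrees (IX)

Record-only file (D-0012) of the abc-iut cell's fork skeleton; TAKES NO SIDE. `ForkHexagon` (XIV) types
LANA's `q`-pilot and Θ-pilot value-group BPSs over abstract positive local degrees `d_v` and DERIVES the
hexagon (Θ-side degree of the Θ-pilot `= s·Σ_{bad} d_v`, through the Θ-link `= Σ_{bad} d_v`);
`Literature.IUT.LogVolume.PilotDivisors` holds Dupuy–Hilado's pilot divisors over a number field `F` and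
`ForkPilots` (IX) the dictionary to Scholze–Stix's weights. This file closes the triangle: over the bad places
`S` of `X : PilotData F` with LANA's local degrees `d_v := deg(q̲_v) = (ord_v(q_v)/2l)·log N(v)` (§4.2 (c):
"`φ_v = deg(q̲_v)` (`v ∈ V^bad`)", `deg(a) := [F:ℚ]⁻¹ log #(O_{F_v}/a O_{F_v})` up to the global
normalisation), LANA's `q`-pilot IS `deĝ(P_q)` (`qBPS_pilot_eq_deg_qPilot`), the Θ-side degree of LANA's
Θ-pilot IS `deĝ_lgp(P_Θ)` (`thetaDeg_pilot_eq_degLgp`), and its image through the Θ-link IS `deĝ(P_q)`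
(`thetaLink_pilot_eq_deg_qPilot`): the three vocabularies — Scholze–Stix's weights `j²`, Dupuy–Hilado's pilot
divisors, LANA's BPSs — name the same two real numbers, and the two numbers of Mochizuki's (Syp2)
(`ForkPilots.degLgp_thetaPilot_ne_deg_qPilot`) are the two routes of the hexagon evaluated on LANA's Θ-pilot.
(Only the bad places are carried, `V = V^bad = S`: the pilots live there; good/archimedean places enter LANA's
BPS only through the product formula, cf. `ForkHexagon.badScaledBPS_not_iso`.)
[cite: LANA2026Report, §4.2 (c) p. 26, §7.1 (a) p. 37, §10.2 p. 47] [cite: DupuyHilado2025, Def. 3.1.1, §3.3]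
[cite: Mochizuki2022EssLgc, §3.6 (Syp2) p. 104] Deliberately NOT here: any judgement.
-/

noncomputable section

open Finset Literature.IUT.LogVolume

namespace Summit.ABC

namespace IUTFork

variable {F : Type} [Field F] [NumberField F] (X : PilotData F)

/-- LANA's local degrees §4.2 (c) at the bad places `S` of the pilot data: `d_v := deg(q̲_v) =
(ord_v(q_v)/2l)·log N(v) > 0` (all places bad: `V = V^bad = S`), `ℓ⋇ := ℓ⋇(X)`.
[cite: LANA2026Report, §4.2 (c) p. 26] -/
def pilotLocalDegrees : LocalDegrees X.S Finset.univ where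
  d v := (X.ordq v.1 : ℝ) / (2 * X.l) * logNorm F v.1
  d_pos v := by
    have h1 : (0 : ℝ) < X.ordq v.1 := by exact_mod_cast X.ordq_pos v.2
    have h2 := logNorm_pos F v.1
    have hl := X.two_mul_l_pos
    positivity
  bad_nonempty := by
    obtain ⟨v, hv⟩ := X.S_nonempty
    exact ⟨⟨v, hv⟩, Finset.mem_univ _⟩
  lstar := X.lstar
  two_le_lstar := X.two_le_lstar

/-- The bad-place sum of LANA's local degrees is `deĝ(P_q) = (1/2l)·deĝ(𝔮)`. [cite: DupuyHilado2025, §3.3] -/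
theorem sum_pilotLocalDegrees :
    ∑ v ∈ (Finset.univ : Finset X.S), (pilotLocalDegrees X).d v = FinDivisor.deg F X.qPilot := by
  rw [X.deg_qPilot, X.deg_qDivisor, Finset.mul_sum,
    ← Finset.sum_coe_sort X.S (fun v => 1 / (2 * (X.l : ℝ)) * ((X.ordq v : ℝ) * logNorm F v))]
  refine Finset.sum_congr rfl fun v _ => ?_
  simp only [pilotLocalDegrees]
  ring

/-- **LANA's `q`-pilot `φ_{C_q} = Σ_{v∈V^bad} deg(q̲_v)` IS Dupuy–Hilado's `deĝ(P_q)`** (`= |log(q)|`).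
[cite: LANA2026Report, §4.2 (c) p. 26] -/
theorem qBPS_pilot_eq_deg_qPilot : (pilotLocalDegrees X).qBPS.pilot = FinDivisor.deg F X.qPilot := by
  rw [LocalDegrees.qBPS_pilot, sum_pilotLocalDegrees]

/-- **The Θ-side degree of LANA's Θ-pilot IS `deĝ_lgp(P_Θ)`**: `s·Σ_{bad} deg(q̲_v)` (`ForkHexagon.hexagon_not_commute`)
`= w̄·deĝ(P_q) = deĝ_lgp(P_Θ)` (`ForkPilots.degLgp_thetaPilot_eq_avgWeightAt`).
[cite: LANA2026Report, §7.1 (a) p. 37, §10.2 p. 47] -/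
theorem thetaDeg_pilot_eq_degLgp :
    (pilotLocalDegrees X).thetaDeg (pilotLocalDegrees X).s_pos
        ((pilotLocalDegrees X).thetaBPS (pilotLocalDegrees X).s_pos).pilot =
      LgpDivisor.degLgp X.thetaPilot := by
  rw [(pilotLocalDegrees X).hexagon_not_commute.1, LocalDegrees.s_eq_avgWeightAt, sum_pilotLocalDegrees,
    degLgp_thetaPilot_eq_avgWeightAt]
  rfl

/-- **… and through the Θ-link it IS `deĝ(P_q)`**: the two numbers of (Syp2) — "taking log-volumes of pilot
objects in the domain and codomain of the Θ-link yields the same real number [a property which, in fact, can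
never be proved since it is false! — cf. the discussion of §3.5]" — are the two routes of the hexagon on LANA's
Θ-pilot (`ForkPilots.degLgp_thetaPilot_ne_deg_qPilot`). [cite: Mochizuki2022EssLgc, §3.6 (Syp2) p. 104] -/
theorem thetaLink_pilot_eq_deg_qPilot :
    (pilotLocalDegrees X).qDeg (((pilotLocalDegrees X).thetaLink (pilotLocalDegrees X).s_pos).toEquiv
        ((pilotLocalDegrees X).thetaBPS (pilotLocalDegrees X).s_pos).pilot) = FinDivisor.deg F X.qPilot := by
  rw [(pilotLocalDegrees X).hexagon_not_commute.2.1, sum_pilotLocalDegrees]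

/-- Hence the hexagon's two routes on LANA's Θ-pilot differ by exactly `deĝ_lgp(P_Θ) − deĝ(P_q) > 0`, the gap
of `ForkInflation` (Literature `degLgp_thetaPilot_sub_deg_qPilot`: `= ((l+1)/24 − 1/(2l))·deĝ(𝔮)`).
[cite: DupuyHilado2025, §3.3] -/
theorem hexagon_gap_eq :
    (pilotLocalDegrees X).thetaDeg (pilotLocalDegrees X).s_pos
          ((pilotLocalDegrees X).thetaBPS (pilotLocalDegrees X).s_pos).pilot -
        (pilotLocalDegrees X).qDeg (((pilotLocalDegrees X).thetaLink (pilotLocalDegrees X).s_pos).toEquiv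
          ((pilotLocalDegrees X).thetaBPS (pilotLocalDegrees X).s_pos).pilot) =
      LgpDivisor.degLgp X.thetaPilot - FinDivisor.deg F X.qPilot := by
  rw [thetaDeg_pilot_eq_degLgp, thetaLink_pilot_eq_deg_qPilot]

end IUTFork

end Summit.ABC

end
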